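import Summits.BirchSwinnertonDyer.Rank1Residual.GaloisImage.KatoKuriharaValueEmptyLevel
import Summits.BirchSwinnertonDyer.Rank1Residual.GaloisImage.KolyvaginDerivativeCoefficientChange
import Summits.BirchSwinnertonDyer.Rank1Residual.GaloisImage.KatoDepletedLValue
import Literature.NumberTheory.EllipticCurves.KatoTwistedFinitenessTrivialCharacterProofs
import HarnessLib

/-!
# The empty-level value clause: SOCKETS for the PORT END PK-6 — THEOREM D's currency (the pin)
# and the depletion identity discharged by PK-L (sub-target R1-68 "PK-6-m1", file 2;
# cell `b2b-bsdres`, team n1011, seat p13 GEN 13)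

HONEST FRAMING (cell `b2b-bsdres`, run/shared/lean/b2b/bsd-rank1-residual/, verbatim in every
file): the goal of the cell is to DELETE the COMBINATION-SHAPED residual classes of the
Birch–Swinnerton-Dyer formula for ALL analytic-rank `≤ 1` elliptic curves over `ℚ` — "full BSD
formula for every rank `≤ 1` curve in class `C`" assembled STRICTLY from published theorems — so
that the rank-`≤ 1` remainder becomes exactly the CONSTRUCTION-SHAPED classes, which are TYPED
(missing-input `Prop`s), NOT attempted. This is not "finishing BSD". Team n1011: research route on
the CONSTRUCTION-SHAPED class X4 / §I N11 (route-1 PORT `T-PORT-1`, (P-KIM)).  TOOL theorems; NO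
Euler system is asserted to exist; no definition, no named fact, no `sorry`; nothing booked.

## What

`KatoValue.apply_localization_eq_unit_mul_kuriharaNumber_one` (file 1) takes the class at the
empty level in the shape `res κ₀ = Ψ(z_{0,∅})` for ANY additive `Ψ : H¹(ℚ, T_pE) → H¹(ℚ, E[p^k·p])`
computed on cocycles by `a ↦ a_{k+1}` (ROUTE-1 §53.4 deviation δ2 of `KatoExpStarFiniteLevelAt`).
THEOREM D of row T-DER (`KolyvaginSystemOfEulerSystem*`, n1011-p11) delivers the derivative classes
as `res κ_r = D_r (Φ_r (red_* c_{⊥,r}))` for a coefficient map `red : T_pE ⟶ T′` and transports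
`Φ_r` computed on cocycles by an isomorphism `e : T′ ≅ E[p^k·p]`; at `r = ∅` the derivative `D_∅`
is `1`.  This file supplies the glue:
* `comp_oneCocycleClass_eq_of_pin` — under the PIN `e ∘ red = (a ↦ a_{k+1})` the composite
  `Φ ∘ red_*` is computed on cocycles by `a ↦ a_{k+1}` (by n1011-p13 GEN 12's
  `Derivative.CoeffChange.map_id_oneCocycleClass`), so it is an admissible `Ψ`;
* `apply_localization_eq_unit_mul_kuriharaNumber_one_of_pin` — file 1's value clause with
  `hres : res κ₀ = Φ (red_* z_{0,∅})` and the pin displayed;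
* `isDepletedTwistedL_one_of_cycLevel`, `exists_continuation_cuspFormLSeries` and
  ★ `apply_localization_eq_unit_mul_kuriharaNumber_one_of_depleted` — file 1's displayed depletion
  identity `hdepl : L_{(pA)}(f,1) = E · L(f,1)` DISCHARGED by n1011-p02's PK-L
  `DepletedLValue.depletedTwistedL_one_eq_ratCast_prod_mul` with the EXPLICIT rational
  `E = ∏_{q ∣ pA} (1 − a_q(W)/q + 𝟙_{q∤N}/q)`; only the two `p`-adic-unit CERTIFICATES of the row
  (`E ≠ 0`, `padicValRat p E = 0`; `R⁻ ≠ 0`, `padicValRat p R⁻ = 0`) stay displayed (ROUTE-1 §53.5 /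
  r1's L3: no unit claim inside a tool).
References: as file 1; K. Rubin, *Euler Systems* (2000), Def. 4.4.4 [Rubin2000].
-/

noncomputable section

open scoped NumberField TensorProduct MatrixGroups
open CategoryTheory Field IsDedekindDomain NumberField WeierstrassCurve CongruenceSubgroup
open Literature.NumberTheory.GaloisRepresentations
open Literature.NumberTheory.EllipticCurves Literature.NumberTheory.EllipticCurves.ModularForms
open Literature.NumberTheory.EllipticCurves.Kato2004
open Literature.NumberTheory.EllipticCurves.Kato2004.EulerSystemValues
open Literature.NumberTheory.DiophantineGeometry.Dioph (ratModP)

namespace Summit.BirchSwinnertonDyer.Rank1Residual.GaloisImage.KatoValue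

section Glue

variable {W : WeierstrassCurve ℚ} [W.IsElliptic] {p : ℕ} [Fact p.Prime]
  [ContinuousSMul ℤ_[p] (W.tateModule p)]

/-! ### Glue to THEOREM D's currency (ROUTE-1 §53.4 δ2) -/

/-- **Glue lemma**: the composite `Φ ∘ red_*` of a coefficient map `red : T_pE ⟶ T′` pushed to
`H¹(U, ·)` and a transport `Φ : H¹(U, T′) → H¹(U, E[M])` computed on cocycles by `e : T′ → E[M]`
(THEOREM D's `Φ_r`, `KolyvaginSystemOfEulerSystem`), under the PIN `e ∘ red = (a ↦ a_{k+1})`, is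
computed on cocycles by `a ↦ a_{k+1}` — an admissible `Ψ` for `KatoExpStarFiniteLevelAt` (ii)
(`Derivative.CoeffChange.map_id_oneCocycleClass`). [folklore] -/
theorem comp_oneCocycleClass_eq_of_pin {k : ℕ} {M : ℤ}
    {M' : Type} [AddCommGroup M'] [Module ℤ_[p] M'] [TopologicalSpace M'] [IsTopologicalAddGroup M']
    [ContinuousSMul ℤ_[p] M'] {T' : GaloisRep ℚ ℤ_[p] M'}
    (red : (tateRep W p).toTopRep ⟶ T'.toTopRep)
    (e : M' →+ geomTorsion W M)
    (hpin : ∀ a : W.tateModule p,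
      ((e (red.hom a) : geomTorsion W M) : geomPoints W) = TateModule.proj p (k + 1) a)
    (U : Subgroup (absoluteGaloisGroup ℚ))
    (Φ : continuousCohomology 1 (subgroupRep T'.toTopRep U) →+
      continuousCohomology 1 (subgroupRep (W.torsionGaloisModule M).toTopRep U))
    (hΦ : ∀ (φ : contOneCocycles (subgroupRep T'.toTopRep U))
      (ψ : contOneCocycles (subgroupRep (W.torsionGaloisModule M).toTopRep U)),
      (∀ g, ψ.1 g = e (φ.1 g)) → Φ (oneCocycleClass _ φ) = oneCocycleClass _ ψ)
    (φ : contOneCocycles (subgroupRep (tateRep W p).toTopRep U))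
    (ψ : contOneCocycles (subgroupRep (W.torsionGaloisModule M).toTopRep U))
    (hφψ : ∀ g, ((ψ.1 g : geomTorsion W M) : geomPoints W) = TateModule.proj p (k + 1) (φ.1 g)) :
    Φ (ContinuousCohomology.map (ContinuousMonoidHom.id U)
        (X := subgroupRep (tateRep W p).toTopRep U) (Y := subgroupRep T'.toTopRep U)
        ((TopRep.resFunctor U.subtype).map red) 1 (oneCocycleClass _ φ)) =
      oneCocycleClass _ ψ := by
  set π := (TopRep.resFunctor U.subtype).map red with hπ
  let φ' : contOneCocycles (subgroupRep T'.toTopRep U) :=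
    ⟨_, CoeffTransport.comp_mem_contOneCocycles (subgroupRep (tateRep W p).toTopRep U)
      (subgroupRep T'.toTopRep U) (π.hom : _ →+ _) π.hom.continuous
      (fun g x => TopRep.hom_comm_apply π g x) φ⟩
  rw [Derivative.CoeffChange.map_id_oneCocycleClass π φ φ' (fun _ => rfl)]
  refine hΦ φ' ψ fun g => Subtype.ext ?_
  rw [hφψ g]
  exact (hpin (φ.1 g)).symm


end Glue

section Main

variable {W : WeierstrassCurve ℚ} [W.IsElliptic] [W.IsGloballyMinimal] {p : ℕ} [Fact p.Prime]
  [ContinuousSMul ℤ_[p] (W.tateModule p)] [Module.Free ℤ_[p] (W.tateModule p)]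
  [Module.Finite ℤ_[p] (W.tateModule p)] {N : ℕ} [NeZero N] {f : CuspForm (Gamma0 N) 2}
  {ι : (m : ℕ) → (CyclotomicField m ℚ →+* ℂ)} {κ : ℝ}
  {Λ : ∀ (k : ℕ) (r : Finset (HeightOneSpectrum (𝓞 ℚ))),
    H1 (tateRep W p) (cycSubgroup p k r) →ₗ[ℤ_[p]] ℚ_[p] ⊗[ℚ] CyclotomicField (cycLevel p k r) ℚ}
  {c d a : ℤ} {A : ℕ}
  {z : ∀ (k : ℕ) (r : (cyclotomicLevelsRat p (badPlaces c d A N)).Ideals),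
    H1 (tateRep W p) ((cyclotomicLevelsRat p (badPlaces c d A N)).level k r.1)}
  {x : ∀ (k : ℕ) (r : (cyclotomicLevelsRat p (badPlaces c d A N)).Ideals),
    CyclotomicField (cycLevel p k r.1) ℚ}

/-- **The same value clause in THEOREM D's currency**: the class given as THEOREM D delivers it —
`res κ₀ = Φ (red_* z_{0,∅})` (the empty derivative `D_∅ = 1`) for a coefficient map
`red : T_pE ⟶ T′`, a transport `Φ` computed on cocycles by `e : T′ → E[p^k·p]`, and the pin
`e ∘ red = (a ↦ a_{k+1})` (`comp_oneCocycleClass_eq_of_pin`).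
[cite: Kim2022StructureSelmer, §1.4.3 and the proof of Thm. 3.13 (arXiv v3 pp. 26–27; = Thm. 3.11 of AJM 148)] -/
theorem apply_localization_eq_unit_mul_kuriharaNumber_one_of_pin
    (hbody : ZetaBody W p f ι κ Λ c d a A z x) (hf : IsNewformOf W f) (hp2 : p ≠ 2)
    (hirr : W.HasIrreducibleModPGaloisRep p)
    {k t : ℕ} {v : HeightOneSpectrum (𝓞 ℚ)}
    {Λfin : galoisCohomology ((W.torsionGaloisModule ((p : ℤ) ^ k * (p : ℤ))).toLocal
      (Sum.inr v)) 1 →+ ZMod (p ^ (k + 1))}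
    (hfin : KatoExpStarFiniteLevelAt W p k t v Λ Λfin)
    (hNorm : ∃ u : ℚ, (u : ℝ) = κ ∧ padicValRat p u = 0) (hκ0 : κ ≠ 0)
    (d' : ℤ) (hcd : Int.gcd (c * d) A = 1) (hdd' : d * d' ≡ 1 [ZMOD (A : ℤ)])
    {LA Lf : ℂ → ℂ}
    (hLA : IsDepletedTwistedL f (cycLevel p 0 ∅) (p * A) (1 : DirichletCharacter ℂ (cycLevel p 0 ∅)) LA)
    (hLf : Differentiable ℂ Lf) (hLf' : ∀ s : ℂ, 2 < s.re → Lf s = cuspFormLSeries f s)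
    {E : ℚ} (hdepl : LA 1 = (E : ℂ) * Lf 1) (hE0 : E ≠ 0) (hE : padicValRat p E = 0)
    (hR0 : ((c : ℚ) ^ 2 * (d : ℚ) ^ 2 * ratMinusSymbol f ((a : ℚ) / A)
        - (c : ℚ) * (d : ℚ) ^ 2 * ratMinusSymbol f ((a * c : ℚ) / A)
        - (c : ℚ) ^ 2 * (d : ℚ) * ratMinusSymbol f ((a * d' : ℚ) / A)
        + (c : ℚ) * (d : ℚ) * ratMinusSymbol f ((a * c * d' : ℚ) / A)) ≠ 0)
    (hR : padicValRat p ((c : ℚ) ^ 2 * (d : ℚ) ^ 2 * ratMinusSymbol f ((a : ℚ) / A)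
        - (c : ℚ) * (d : ℚ) ^ 2 * ratMinusSymbol f ((a * c : ℚ) / A)
        - (c : ℚ) ^ 2 * (d : ℚ) * ratMinusSymbol f ((a * d' : ℚ) / A)
        + (c : ℚ) * (d : ℚ) * ratMinusSymbol f ((a * c * d' : ℚ) / A)) = 0)
    {M' : Type} [AddCommGroup M'] [Module ℤ_[p] M'] [TopologicalSpace M'] [IsTopologicalAddGroup M']
    [ContinuousSMul ℤ_[p] M'] {T' : GaloisRep ℚ ℤ_[p] M'}
    (red : (tateRep W p).toTopRep ⟶ T'.toTopRep)
    (e : M' →+ geomTorsion W ((p : ℤ) ^ k * (p : ℤ)))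
    (hpin : ∀ a : W.tateModule p,
      ((e (red.hom a) : geomTorsion W ((p : ℤ) ^ k * (p : ℤ))) : geomPoints W) =
        TateModule.proj p (k + 1) a)
    (Φ : continuousCohomology 1 (subgroupRep T'.toTopRep (cycSubgroup p 0 ∅)) →+
      continuousCohomology 1
        (subgroupRep (W.torsionGaloisModule ((p : ℤ) ^ k * (p : ℤ))).toTopRep (cycSubgroup p 0 ∅)))
    (hΦ : ∀ (φ : contOneCocycles (subgroupRep T'.toTopRep (cycSubgroup p 0 ∅)))
      (ψ : contOneCocycles
        (subgroupRep (W.torsionGaloisModule ((p : ℤ) ^ k * (p : ℤ))).toTopRep (cycSubgroup p 0 ∅))),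
      (∀ g, ψ.1 g = e (φ.1 g)) → Φ (oneCocycleClass _ φ) = oneCocycleClass _ ψ)
    (κ₀ : galoisCohomology (W.torsionGaloisModule ((p : ℤ) ^ k * (p : ℤ))) 1)
    (hres : resSubgroup (W.torsionGaloisModule ((p : ℤ) ^ k * (p : ℤ))).toTopRep (cycSubgroup p 0 ∅)
      1 κ₀ = Φ (ContinuousCohomology.map (ContinuousMonoidHom.id (cycSubgroup p 0 ∅))
        (X := subgroupRep (tateRep W p).toTopRep (cycSubgroup p 0 ∅))
        (Y := subgroupRep T'.toTopRep (cycSubgroup p 0 ∅))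
        ((TopRep.resFunctor (cycSubgroup p 0 ∅).subtype).map red) 1
        (z 0 (cyclotomicLevelsRat p (badPlaces c d A N)).idealOne)))
    (hloc : galoisCohomology.localization (W.torsionGaloisModule ((p : ℤ) ^ k * (p : ℤ))) (Sum.inr v)
      1 κ₀ ∈ propagatedSelmerStructure W p k (Sum.inr v))
    (ψ : (ℓ : ℕ) → (ZMod ℓ)ˣ →* Multiplicative (ZMod (p ^ (k + 1)))) :
    ∃ u : (ZMod (p ^ (k + 1)))ˣ,
      Λfin (galoisCohomology.localization (W.torsionGaloisModule ((p : ℤ) ^ k * (p : ℤ)))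
          (Sum.inr v) 1 κ₀) =
        (u : ZMod (p ^ (k + 1))) * (p : ZMod (p ^ (k + 1))) ^ t * kuriharaNumber f (p ^ (k + 1)) 1 ψ := by
  let Ψ : H1 (tateRep W p) (cycSubgroup p 0 ∅) →+
      continuousCohomology 1
        (subgroupRep (W.torsionGaloisModule ((p : ℤ) ^ k * (p : ℤ))).toTopRep (cycSubgroup p 0 ∅)) :=
    Φ.comp (ContinuousCohomology.map (ContinuousMonoidHom.id (cycSubgroup p 0 ∅))
        (X := subgroupRep (tateRep W p).toTopRep (cycSubgroup p 0 ∅))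
        (Y := subgroupRep T'.toTopRep (cycSubgroup p 0 ∅))
        ((TopRep.resFunctor (cycSubgroup p 0 ∅).subtype).map red) 1).hom.toLinearMap.toAddMonoidHom
  exact apply_localization_eq_unit_mul_kuriharaNumber_one hbody hf hp2 hirr hfin hNorm hκ0 d' hcd hdd'
    hLA hLf hLf' hdepl hE0 hE hR0 hR Ψ
    (fun φ ψ' h => comp_oneCocycleClass_eq_of_pin red e hpin _ Φ hΦ φ ψ' h) κ₀ hres hloc ψ

end Main


/-! ### The depletion identity discharged (PK-L, n1011-p02 `KatoDepletedLValue`) -/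

section Depleted

/-- Level bridge: an `IsDepletedTwistedL` datum at the bottom level `cycLevel p 0 ∅` is one at the
literal level `1` (`cycLevel p 0 ∅ = 1`). [folklore] -/
theorem isDepletedTwistedL_one_of_cycLevel {N : ℕ} {f : CuspForm (Gamma0 N) 2} {p M : ℕ}
    {L : ℂ → ℂ}
    (hL : IsDepletedTwistedL f (cycLevel p 0 ∅) M (1 : DirichletCharacter ℂ (cycLevel p 0 ∅)) L) :
    IsDepletedTwistedL f 1 M (1 : DirichletCharacter ℂ 1) L := by
  have key : ∀ m : ℕ, m = 1 → IsDepletedTwistedL f m M (1 : DirichletCharacter ℂ m) L →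
      IsDepletedTwistedL f 1 M (1 : DirichletCharacter ℂ 1) L := by
    rintro m rfl h; exact h
  exact key _ (cycLevel_zero_empty p) hL

/-- An entire continuation of `L(f, s)` exists (the tree's twisted continuation at the trivial
character, `exists_differentiable_eq_twistedLSeries_holds`, Shimura 1971 Thm. 3.66). [folklore] -/
theorem exists_continuation_cuspFormLSeries {N : ℕ} [NeZero N] (f : CuspForm (Gamma0 N) 2) :
    ∃ L₀ : ℂ → ℂ, Differentiable ℂ L₀ ∧ ∀ s : ℂ, 2 < s.re → L₀ s = cuspFormLSeries f s := by
  obtain ⟨L₀, hL₀, hL₀s⟩ := exists_differentiable_eq_twistedLSeries_holds f (1 : DirichletCharacter ℂ 1)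
  exact ⟨L₀, hL₀, fun s hs => by rw [hL₀s s hs, twistedLSeries_one_eq_cuspFormLSeries_of_one]⟩

variable {W : WeierstrassCurve ℚ} [W.IsElliptic] [W.IsGloballyMinimal] {p : ℕ} [Fact p.Prime]
  [ContinuousSMul ℤ_[p] (W.tateModule p)] [Module.Free ℤ_[p] (W.tateModule p)]
  [Module.Finite ℤ_[p] (W.tateModule p)] {N : ℕ} [NeZero N] {f : CuspForm (Gamma0 N) 2}
  {ι : (m : ℕ) → (CyclotomicField m ℚ →+* ℂ)} {κ : ℝ}
  {Λ : ∀ (k : ℕ) (r : Finset (HeightOneSpectrum (𝓞 ℚ))),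
    H1 (tateRep W p) (cycSubgroup p k r) →ₗ[ℤ_[p]] ℚ_[p] ⊗[ℚ] CyclotomicField (cycLevel p k r) ℚ}
  {c d a : ℤ} {A : ℕ}
  {z : ∀ (k : ℕ) (r : (cyclotomicLevelsRat p (badPlaces c d A N)).Ideals),
    H1 (tateRep W p) ((cyclotomicLevelsRat p (badPlaces c d A N)).level k r.1)}
  {x : ∀ (k : ℕ) (r : (cyclotomicLevelsRat p (badPlaces c d A N)).Ideals),
    CyclotomicField (cycLevel p k r.1) ℚ}

set_option backward.isDefEq.respectTransparency false in
/-- **DICT3's value clause at the EMPTY level with the depletion identity DISCHARGED** (PK-L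
`DepletedLValue.depletedTwistedL_one_eq_ratCast_prod_mul`, n1011-p02): the only displayed value
inputs left are the two ROW CERTIFICATES — `E = ∏_{q ∣ pA}(1 − a_q(W)/q + 𝟙_{q∤N}/q)` and `R⁻` are
non-zero `p`-adic units (at an additive `p` the `q = p` factor of `E` is `1`: `a_p = 0`, `p ∣ N`).
[cite: Kim2022StructureSelmer, §1.4.3 and the proof of Thm. 3.13 (arXiv v3 pp. 26–27; = Thm. 3.11 of AJM 148)]
[cite: Kato2004Asterisque, Thm. 9.7 (p. 189) and Thm. 6.6 (1) (p. 163)] -/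
theorem apply_localization_eq_unit_mul_kuriharaNumber_one_of_depleted
    (hbody : ZetaBody W p f ι κ Λ c d a A z x) (hf : IsNewformOf W f) (hp2 : p ≠ 2)
    (hirr : W.HasIrreducibleModPGaloisRep p)
    {k t : ℕ} {v : HeightOneSpectrum (𝓞 ℚ)}
    {Λfin : galoisCohomology ((W.torsionGaloisModule ((p : ℤ) ^ k * (p : ℤ))).toLocal
      (Sum.inr v)) 1 →+ ZMod (p ^ (k + 1))}
    (hfin : KatoExpStarFiniteLevelAt W p k t v Λ Λfin)
    (hNorm : ∃ u : ℚ, (u : ℝ) = κ ∧ padicValRat p u = 0) (hκ0 : κ ≠ 0)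
    (d' : ℤ) [NeZero A] (hcd : Int.gcd (c * d) A = 1) (hdd' : d * d' ≡ 1 [ZMOD (A : ℤ)])
    {LA : ℂ → ℂ}
    (hLA : IsDepletedTwistedL f (cycLevel p 0 ∅) (p * A) (1 : DirichletCharacter ℂ (cycLevel p 0 ∅)) LA)
    (hE : padicValRat p (∏ q ∈ (p * A).primeFactors,
      (1 - (W.LFunction q : ℚ) / q + if q ∣ N then 0 else (1 : ℚ) / q)) = 0)
    (hR0 : ((c : ℚ) ^ 2 * (d : ℚ) ^ 2 * ratMinusSymbol f ((a : ℚ) / A)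
        - (c : ℚ) * (d : ℚ) ^ 2 * ratMinusSymbol f ((a * c : ℚ) / A)
        - (c : ℚ) ^ 2 * (d : ℚ) * ratMinusSymbol f ((a * d' : ℚ) / A)
        + (c : ℚ) * (d : ℚ) * ratMinusSymbol f ((a * c * d' : ℚ) / A)) ≠ 0)
    (hR : padicValRat p ((c : ℚ) ^ 2 * (d : ℚ) ^ 2 * ratMinusSymbol f ((a : ℚ) / A)
        - (c : ℚ) * (d : ℚ) ^ 2 * ratMinusSymbol f ((a * c : ℚ) / A)
        - (c : ℚ) ^ 2 * (d : ℚ) * ratMinusSymbol f ((a * d' : ℚ) / A)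
        + (c : ℚ) * (d : ℚ) * ratMinusSymbol f ((a * c * d' : ℚ) / A)) = 0)
    (Ψ : H1 (tateRep W p) (cycSubgroup p 0 ∅) →+
      continuousCohomology 1
        (subgroupRep (W.torsionGaloisModule ((p : ℤ) ^ k * (p : ℤ))).toTopRep (cycSubgroup p 0 ∅)))
    (hΨ : ∀ (φ : contOneCocycles (subgroupRep (tateRep W p).toTopRep (cycSubgroup p 0 ∅)))
        (ψ : contOneCocycles
          (subgroupRep (W.torsionGaloisModule ((p : ℤ) ^ k * (p : ℤ))).toTopRep (cycSubgroup p 0 ∅))),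
        (∀ g, ((ψ.1 g : geomTorsion W ((p : ℤ) ^ k * (p : ℤ))) : geomPoints W) =
          TateModule.proj p (k + 1) (φ.1 g)) →
        Ψ (oneCocycleClass _ φ) = oneCocycleClass _ ψ)
    (κ₀ : galoisCohomology (W.torsionGaloisModule ((p : ℤ) ^ k * (p : ℤ))) 1)
    (hres : resSubgroup (W.torsionGaloisModule ((p : ℤ) ^ k * (p : ℤ))).toTopRep (cycSubgroup p 0 ∅)
      1 κ₀ = Ψ (z 0 (cyclotomicLevelsRat p (badPlaces c d A N)).idealOne))
    (hloc : galoisCohomology.localization (W.torsionGaloisModule ((p : ℤ) ^ k * (p : ℤ))) (Sum.inr v)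
      1 κ₀ ∈ propagatedSelmerStructure W p k (Sum.inr v))
    (ψ : (ℓ : ℕ) → (ZMod ℓ)ˣ →* Multiplicative (ZMod (p ^ (k + 1)))) :
    ∃ u : (ZMod (p ^ (k + 1)))ˣ,
      Λfin (galoisCohomology.localization (W.torsionGaloisModule ((p : ℤ) ^ k * (p : ℤ)))
          (Sum.inr v) 1 κ₀) =
        (u : ZMod (p ^ (k + 1))) * (p : ZMod (p ^ (k + 1))) ^ t * kuriharaNumber f (p ^ (k + 1)) 1 ψ := by
  haveI : NeZero (p * A) := ⟨Nat.mul_ne_zero (Fact.out : p.Prime).ne_zero (NeZero.ne A)⟩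
  obtain ⟨Lf, hLf, hLf'⟩ := exists_continuation_cuspFormLSeries f
  have hdepl := DepletedLValue.depletedTwistedL_one_eq_ratCast_prod_mul hf
    (isDepletedTwistedL_one_of_cycLevel hLA) hLf hLf'
  -- `E ≠ 0`: the Euler factors at `s = 1` do not vanish (Hasse bound, tree `eulerFactors_one_ne_zero`)
  have hE0 : (∏ q ∈ (p * A).primeFactors,
      (1 - (W.LFunction q : ℚ) / q + if q ∣ N then 0 else (1 : ℚ) / q)) ≠ 0 := by
    have hne := eulerFactors_one_ne_zero hf (1 : DirichletCharacter ℂ 1) (S := (p * A).primeFactors)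
      (fun q hq => ⟨Nat.prime_of_mem_primeFactors hq,
        fun h => (Nat.prime_of_mem_primeFactors hq).ne_one (Nat.dvd_one.mp h)⟩)
    intro h0
    apply hne
    have hcast : (∏ q ∈ (p * A).primeFactors,
        (1 - (1 : DirichletCharacter ℂ 1) (q : ZMod 1) * cuspCoeff f q * (q : ℂ) ^ (-(1 : ℂ)) +
          (if q ∣ N then 0 else (q : ℂ)) * (1 : DirichletCharacter ℂ 1) (q : ZMod 1) ^ 2 *
            ((q : ℂ) ^ (-(1 : ℂ))) ^ 2)) =
        ((∏ q ∈ (p * A).primeFactors,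
          (1 - (W.LFunction q : ℚ) / q + if q ∣ N then 0 else (1 : ℚ) / q) : ℚ) : ℂ) := by
      rw [Rat.cast_prod]
      refine Finset.prod_congr rfl fun q hq => ?_
      exact DepletedLValue.eulerFactor_one_eq_ratCast hf 1 (Nat.prime_of_mem_primeFactors hq)
        (MulChar.one_apply (isUnit_of_subsingleton _))
    rw [hcast, h0, Rat.cast_zero]
  exact apply_localization_eq_unit_mul_kuriharaNumber_one hbody hf hp2 hirr hfin hNorm hκ0 d' hcd hdd'
    hLA hLf hLf' hdepl hE0 hE hR0 hR Ψ hΨ κ₀ hres hloc ψ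

end Depleted

end Summit.BirchSwinnertonDyer.Rank1Residual.GaloisImage.KatoValue

end
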